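import Summits.CriticalPhenomena.PercolationContinuityZ3.Theorems.PercNearOneGluingNoHeavyLowerTailCILSetStarTools
import HarnessLib

/-!
# `NoHeavyLowerTail` (stmt-CriticalPhenomena-4575) — an observer set with at most TWO GATES: reachability

Support file (prover `prim-gen-induct`, blob-quotient / cumulative-isolation line, gen 3; `--supports
stmt-CriticalPhenomena-4575`).  No definitions, no named facts, no sorries.  First of three files
(`…CILTwoGateReach`, `…CILTwoGateTools`, `…CILTwoGate`) proving the non-adjacent induction STEP of `setCS_of_step`
(`…CILInductionStep`) for an observer set `S` all of whose positive-weight pairs to the outside end in two vertices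
`y ≠ z` (crux notes BLOBQUOTIENT.md §20).

Notation as in `…CILSetStarTools`: `ξ(ω) = ω ∩ {e | ∀ v ∈ S, v ∉ e}` (configuration OFF `S`, "`K = H − S`"), `~'`
reachability in `ξ`, gates `Γ(ω) = {u ∉ S | ∃ v ∈ S, s(u,v) ∈ ω}`; and `R = {y ~ z in ω ∩ {e | e meets S}}` ("`y` and
`z` are joined THROUGH `S`").

* `TwoGate.gate_cases_of_support`, `measureReal_gate_not_mem_powerset` — under `N(S) ⊆ {y,z}` every gate is `y` or `z`
  on the support, so `Γ ∈ 𝒫({y,z})` almost surely; `subset_pair_cases` lists `𝒫({y,z})`;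
* `TwoGate.reach_iff` — for `a, b ∉ S`: `a ~ b` iff `a ~' b`, or `R` and `a ~' {y,z}`, `{y,z} ~' b` (one walk induction
  with the invariant "outside `S`: reached; inside `S`: entered from a reached gate through edges meeting `S`");
* `TwoGate.gateEq_pair_of_R` — `R ⊆ {Γ = {y,z}}`;
* `TwoGate.measureReal_on_inter_off` — an event read off the edges meeting `S` is independent of an event read off `ξ`.
-/

noncomputable section

namespace Summit.CriticalPhenomena.PercolationContinuityZ3.Theorems

open MeasureTheory Set Literature.Probability.LatticeModels Literature.Probability.Percolation
open scoped Classical BigOperators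

variable {n : ℕ}

namespace CutObserver

namespace TwoGate

/-! ### Support: the gates lie in `{y, z}` -/

/-- On a configuration of positive-weight edges, every gate of `S` is `y` or `z` (hypothesis `N(S) ⊆ {y,z}`). [folklore] -/
theorem gate_cases_of_support (w : Sym2 (Fin n) → unitInterval) {S : Finset (Fin n)} {y z : Fin n}
    (hsupp : ∀ v ∈ S, ∀ u, u ∉ S → w s(v, u) ≠ 0 → u = y ∨ u = z)
    {ω : BondConfig (Fin n)} (hω : ∀ e ∈ ω, w e ≠ 0) :
    ∀ u, u ∉ S → (∃ v ∈ S, s(u, v) ∈ ω) → u = y ∨ u = z := by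
  intro u hu ⟨v, hv, huv⟩
  refine hsupp v hv u hu ?_
  rw [Sym2.eq_swap]
  exact hω _ huv

/-- Almost surely the gate set is a subset of `{y, z}`: `μ{Γ ∉ 𝒫({y,z})} = 0`. [folklore] -/
theorem measureReal_gate_not_mem_powerset (w : Sym2 (Fin n) → unitInterval) (S : Finset (Fin n)) {y z : Fin n}
    (hsupp : ∀ v ∈ S, ∀ u, u ∉ S → w s(v, u) ≠ 0 → u = y ∨ u = z) :
    (prodBernoulli w).real {ω : BondConfig (Fin n) |
      (Finset.univ.filter fun u => u ∉ S ∧ ∃ v ∈ S, s(u, v) ∈ ω) ∉ ({y, z} : Finset (Fin n)).powerset} = 0 := by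
  rw [← measureReal_inter_support w]
  have hempty : {ω : BondConfig (Fin n) |
      (Finset.univ.filter fun u => u ∉ S ∧ ∃ v ∈ S, s(u, v) ∈ ω) ∉ ({y, z} : Finset (Fin n)).powerset} ∩
      {ω | ∀ e ∈ ω, w e ≠ 0} = ∅ := by
    ext ω
    simp only [mem_inter_iff, mem_setOf_eq, mem_empty_iff_false, iff_false, not_and]
    intro hno hω
    apply hno
    rw [Finset.mem_powerset]
    intro u hu
    obtain ⟨-, huS, hex⟩ := Finset.mem_filter.1 hu
    rcases gate_cases_of_support w hsupp hω u huS hex with rfl | rfl <;> simp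
  rw [hempty, measureReal_empty]

/-- A subset of `{y, z}` is one of `∅, {y}, {z}, {y, z}`. [folklore] -/
theorem subset_pair_cases {y z : Fin n} {Y : Finset (Fin n)} (hY : Y ⊆ {y, z}) :
    Y = ∅ ∨ Y = {y} ∨ Y = {z} ∨ Y = {y, z} := by
  by_cases hy : y ∈ Y
  · by_cases hz : z ∈ Y
    · refine Or.inr (Or.inr (Or.inr (Finset.Subset.antisymm hY ?_)))
      intro u hu
      simp only [Finset.mem_insert, Finset.mem_singleton] at hu
      rcases hu with rfl | rfl
      · exact hy
      · exact hz
    · refine Or.inr (Or.inl (Finset.Subset.antisymm ?_ (Finset.singleton_subset_iff.2 hy)))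
      intro u hu
      have := hY hu
      simp only [Finset.mem_insert, Finset.mem_singleton] at this
      rcases this with rfl | rfl
      · exact Finset.mem_singleton_self _
      · exact absurd hu hz
  · by_cases hz : z ∈ Y
    · refine Or.inr (Or.inr (Or.inl (Finset.Subset.antisymm ?_ (Finset.singleton_subset_iff.2 hz))))
      intro u hu
      have := hY hu
      simp only [Finset.mem_insert, Finset.mem_singleton] at this
      rcases this with rfl | rfl
      · exact absurd hu hy
      · exact Finset.mem_singleton_self _
    · refine Or.inl (Finset.eq_empty_of_forall_notMem fun u hu => ?_)
      have := hY hu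
      simp only [Finset.mem_insert, Finset.mem_singleton] at this
      rcases this with rfl | rfl
      · exact hy hu
      · exact hz hu

/-! ### Reachability through an observer set with two gates -/

/-- **Reachability with two gates.**  If every gate of `ω` is `y` or `z`, then for `a, b ∉ S`: `a ~ b` iff `a ~' b`, or
`y ~ z` through the edges meeting `S` and `a ~' {y,z}`, `{y,z} ~' b`. [folklore] -/
theorem reach_iff {ω : BondConfig (Fin n)} {S : Finset (Fin n)} {y z : Fin n}
    (hΓ : ∀ u, u ∉ S → (∃ v ∈ S, s(u, v) ∈ ω) → u = y ∨ u = z) {a b : Fin n} (ha : a ∉ S) (hb : b ∉ S) :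
    (openGraph ω).Reachable a b ↔
      ((openGraph (ω ∩ {e | ∀ v ∈ S, v ∉ e})).Reachable a b ∨
        ((openGraph (ω ∩ {e | ∃ v ∈ S, v ∈ e})).Reachable y z ∧
          (∃ u ∈ ({y, z} : Finset (Fin n)), (openGraph (ω ∩ {e | ∀ v ∈ S, v ∉ e})).Reachable a u) ∧
          (∃ u ∈ ({y, z} : Finset (Fin n)), (openGraph (ω ∩ {e | ∀ v ∈ S, v ∉ e})).Reachable u b))) := by
  set ξ := ω ∩ {e | ∀ v ∈ S, v ∉ e} with hξ
  set σ := ω ∩ {e | ∃ v ∈ S, v ∈ e} with hσ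
  -- `Q x`: `x` is reached from `a` in `ξ`, possibly through the glued pair `{y,z}` when `R` holds
  set Q : Fin n → Prop := fun x => (openGraph ξ).Reachable a x ∨
    ((openGraph σ).Reachable y z ∧ (∃ u ∈ ({y, z} : Finset (Fin n)), (openGraph ξ).Reachable a u) ∧
      (∃ u ∈ ({y, z} : Finset (Fin n)), (openGraph ξ).Reachable u x)) with hQ
  constructor
  · rintro ⟨p⟩
    have hQstep : ∀ x x', Q x → (openGraph ξ).Reachable x x' → Q x' := by
      rintro x x' (h | ⟨hR, hau, ⟨u, hu, hux⟩⟩) hxx'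
      · exact Or.inl (h.trans hxx')
      · exact Or.inr ⟨hR, hau, ⟨u, hu, hux.trans hxx'⟩⟩
    -- the invariant along the walk
    have key : ∀ {x t : Fin n} (_ : (openGraph ω).Walk x t),
        ((x ∉ S → Q x) ∧ (x ∈ S → ∃ g ∈ ({y, z} : Finset (Fin n)), Q g ∧ (openGraph σ).Reachable g x)) →
        ((t ∉ S → Q t) ∧ (t ∈ S → ∃ g ∈ ({y, z} : Finset (Fin n)), Q g ∧ (openGraph σ).Reachable g t)) := by
      intro x t q
      induction q with
      | nil => exact id
      | @cons x b t' hadj q ih =>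
        intro hx
        apply ih
        have hadj' := hadj
        rw [openGraph_adj] at hadj'
        obtain ⟨hxb, hne⟩ := hadj'
        by_cases hxS : x ∈ S
        · -- from inside `S`
          obtain ⟨g, hg, hQg, hgx⟩ := hx.2 hxS
          have hσxb : (openGraph σ).Adj x b := by
            rw [openGraph_adj]; exact ⟨⟨hxb, x, hxS, Sym2.mem_mk_left x b⟩, hne⟩
          have hgb : (openGraph σ).Reachable g b := hgx.trans hσxb.reachable
          refine ⟨fun hbS => ?_, fun _ => ⟨g, hg, hQg, hgb⟩⟩
          -- `b` is a gate
          have hb' : b = y ∨ b = z := hΓ b hbS ⟨x, hxS, by rw [Sym2.eq_swap]; exact hxb⟩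
          have hbmem : b ∈ ({y, z} : Finset (Fin n)) := by
            simp only [Finset.mem_insert, Finset.mem_singleton]; exact hb'
          by_cases hgb' : g = b
          · rw [← hgb']; exact hQg
          · -- `g ≠ b`, both in `{y,z}`: `R` holds
            have hR : (openGraph σ).Reachable y z := by
              simp only [Finset.mem_insert, Finset.mem_singleton] at hg
              rcases hg with rfl | rfl <;> rcases hb' with rfl | rfl
              · exact absurd rfl hgb'
              · exact hgb
              · exact hgb.symm
              · exact absurd rfl hgb'
            rcases hQg with h | ⟨_, hau, _⟩
            · exact Or.inr ⟨hR, ⟨g, hg, h⟩, ⟨b, hbmem, SimpleGraph.Reachable.refl _⟩⟩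
            · exact Or.inr ⟨hR, hau, ⟨b, hbmem, SimpleGraph.Reachable.refl _⟩⟩
        · -- from outside `S`
          have hQx : Q x := hx.1 hxS
          refine ⟨fun hbS => ?_, fun hbS => ?_⟩
          · have hξxb : (openGraph ξ).Adj x b := by
              rw [openGraph_adj]
              refine ⟨⟨hxb, ?_⟩, hne⟩
              intro v hvS hv
              rcases Sym2.mem_iff.1 hv with rfl | rfl
              · exact hxS hvS
              · exact hbS hvS
            exact hQstep x b hQx hξxb.reachable
          · -- `x` is a gate
            have hx' : x = y ∨ x = z := hΓ x hxS ⟨b, hbS, hxb⟩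
            have hxmem : x ∈ ({y, z} : Finset (Fin n)) := by
              simp only [Finset.mem_insert, Finset.mem_singleton]; exact hx'
            have hσxb : (openGraph σ).Adj x b := by
              rw [openGraph_adj]; exact ⟨⟨hxb, b, hbS, Sym2.mem_mk_right x b⟩, hne⟩
            exact ⟨x, hxmem, hQx, hσxb.reachable⟩
    have hstart : (a ∉ S → Q a) ∧ (a ∈ S → ∃ g ∈ ({y, z} : Finset (Fin n)), Q g ∧ (openGraph σ).Reachable g a) :=
      ⟨fun _ => Or.inl (SimpleGraph.Reachable.refl _), fun h => absurd h ha⟩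
    exact (key p hstart).1 hb
  · have hξω : ξ ⊆ ω := inter_subset_left
    have hσω : σ ⊆ ω := inter_subset_left
    rintro (h | ⟨hR, ⟨u, hu, hau⟩, ⟨u', hu', hu'b⟩⟩)
    · exact reachable_mono hξω h
    · have huu' : (openGraph ω).Reachable u u' := by
        have hyz : (openGraph ω).Reachable y z := reachable_mono hσω hR
        simp only [Finset.mem_insert, Finset.mem_singleton] at hu hu'
        rcases hu with rfl | rfl <;> rcases hu' with rfl | rfl
        · exact SimpleGraph.Reachable.refl _
        · exact hyz
        · exact hyz.symm
        · exact SimpleGraph.Reachable.refl _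
      exact (reachable_mono hξω hau).trans (huu'.trans (reachable_mono hξω hu'b))

/-- **`R ⊆ {Γ = {y, z}}`**: if `y ≠ z` are joined through the edges meeting `S` (and every gate is `y` or `z`,
`y, z ∉ S`), then both are gates and the gate set is exactly `{y, z}`. [folklore] -/
theorem gateEq_pair_of_R {ω : BondConfig (Fin n)} {S : Finset (Fin n)} {y z : Fin n}
    (hΓ : ∀ u, u ∉ S → (∃ v ∈ S, s(u, v) ∈ ω) → u = y ∨ u = z) (hyz : y ≠ z) (hy : y ∉ S) (hz : z ∉ S)
    (hR : (openGraph (ω ∩ {e | ∃ v ∈ S, v ∈ e})).Reachable y z) :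
    (Finset.univ.filter fun u => u ∉ S ∧ ∃ v ∈ S, s(u, v) ∈ ω) = {y, z} := by
  -- the first edge of a walk in `ω ∩ {e | e meets S}` from a vertex outside `S` enters `S`
  have first : ∀ {g t : Fin n}, g ∉ S → g ≠ t → (openGraph (ω ∩ {e | ∃ v ∈ S, v ∈ e})).Reachable g t →
      ∃ v ∈ S, s(g, v) ∈ ω := by
    intro g t hg hgt ⟨p⟩
    cases p with
    | nil => exact absurd rfl hgt
    | cons hadj p' =>
      rename_i x₁
      rw [openGraph_adj] at hadj
      obtain ⟨⟨hmem, v, hvS, hv⟩, hne⟩ := hadj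
      rcases Sym2.mem_iff.1 hv with rfl | rfl
      · exact absurd hvS hg
      · exact ⟨v, hvS, hmem⟩
  have hyΓ : ∃ v ∈ S, s(y, v) ∈ ω := first hy hyz hR
  have hzΓ : ∃ v ∈ S, s(z, v) ∈ ω := first hz (Ne.symm hyz) hR.symm
  ext u
  simp only [Finset.mem_filter, Finset.mem_univ, true_and, Finset.mem_insert, Finset.mem_singleton]
  constructor
  · rintro ⟨hu, hex⟩; exact hΓ u hu hex
  · rintro (rfl | rfl)
    · exact ⟨hy, hyΓ⟩
    · exact ⟨hz, hzΓ⟩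

/-! ### Independence of the events ON `S` from the events OFF `S` -/

/-- An event read off the edges meeting `S` and an event read off the edges avoiding `S` are independent. [folklore] -/
theorem measureReal_on_inter_off (w : Sym2 (Fin n) → unitInterval) (S : Finset (Fin n))
    (Q P : BondConfig (Fin n) → Prop) :
    (prodBernoulli w).real ({ω : BondConfig (Fin n) | Q (ω ∩ {e | ∃ v ∈ S, v ∈ e})} ∩
        {ω | P (ω ∩ {e | ∀ v ∈ S, v ∉ e})}) =
      (prodBernoulli w).real {ω : BondConfig (Fin n) | Q (ω ∩ {e | ∃ v ∈ S, v ∈ e})} *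
        (prodBernoulli w).real {ω : BondConfig (Fin n) | P (ω ∩ {e | ∀ v ∈ S, v ∉ e})} := by
  have hdisj : Disjoint (Finset.univ.filter fun e : Sym2 (Fin n) => ∃ v ∈ S, v ∈ e)
      (Finset.univ.filter fun e : Sym2 (Fin n) => ∀ v ∈ S, v ∉ e) := by
    rw [Finset.disjoint_left]
    intro e he he'
    obtain ⟨-, v, hv, hve⟩ := Finset.mem_filter.1 he
    exact (Finset.mem_filter.1 he').2 v hv hve
  have hQ : DeterminedBy {ω : BondConfig (Fin n) | Q (ω ∩ {e | ∃ v ∈ S, v ∈ e})}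
      (↑(Finset.univ.filter fun e : Sym2 (Fin n) => ∃ v ∈ S, v ∈ e) : Set (Sym2 (Fin n))) := by
    have h := determinedBy_restrict (Finset.univ.filter fun e : Sym2 (Fin n) => ∃ v ∈ S, v ∈ e) Q
    rw [SetStar.coe_edgesMeeting] at h ⊢
    exact h
  exact prodBernoulli_real_inter_of_determinedBy_disjoint w hdisj hQ (SetStar.determinedBy_off S P)
    MeasurableSet.of_discrete MeasurableSet.of_discrete

end TwoGate

end CutObserver

end Summit.CriticalPhenomena.PercolationContinuityZ3.Theorems

end
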